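import Literature.MathematicalPhysics.QuantumFieldTheory.Balaban1983to89.B9Eq315FlatDictionary
import Literature.MathematicalPhysics.QuantumFieldTheory.Balaban1983to89.B4TorusKernel

/-!
# `Balaban1983to89.B5Eq129FreeResolventGradientRowSites` — T. Bałaban, *Propagators and renormalization transformations for lattice gauge theories. I*,
# Commun. Math. Phys. **95** (1984) 17–40 [Balaban1984PropagatorsI] (1.29) p. 23, p. 36, with *Propagators for lattice gauge theories in a background field*,
# Commun. Math. Phys. **99** (1985) 389–434 [Balaban1985BackgroundPropagators] (3.1) p. 390, (3.3) p. 391, (3.8) p. 392 (the chain's periodic lattice `T_η`, steps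
# `x ± e_μ`) and Thm 3.1 (3.42) p. 397 (the `|∇G|` line): **TRANSPORT OF THE WEIGHTED GRADIENT ROW IN SOLUTION SHAPE FROM b05's TORUS `Tor P` (`± unitVec`)
# TO THE CHAIN's PERIODIC LATTICE `TSite d P` (`shift`∕`unshift`) ALONG THE SITE DICTIONARY `x ↦ (x_i mod P_i)_i`** — the letter
# «`(L₀+m)u = g`, `‖g(y)‖ ≤ F·W_c(y)` ⟹ `‖u(x − e_ν) − u(x)‖ ≤ B·F·W_c(x)`» (vector-valued `u`, product-`cosh` weight `W_c`) taken as a HYPOTHESIS on `Tor P`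
# (the shape of this lineage's `B5Eq129FreeResolventWeightedGradientRowOperator.norm_apply_sub_le_of_resolvent_weighted`) yields the same letter, same
# constant, on `TSite d P` with the weight written as the OWNER's `B9Eq342CoshWeightSite` weight centred at a site `x₀` — the pattern of the OWNER's
# `B5Eq129FreeResolventSupBoundSites.fs_tsite_of_tor` ((FS-t)) for the (K∇) letter of storey J

statement-level skeleton of published theorems with citation tags; proofs where landed; nothing here is a claim about the Yang–Mills mass gap

CITATION HEADER (lean-in-tree rule).  Audit cell `pub-balaban`, sub-cell `t4`, BINDER row NE9; filed by NE9 crux-team LEAF PROVER 05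
(`b2b-balaban-t4-ne9-formalise-leaf-05`, gen 82).  PATTERN: the row OWNER t4-ne9-p1 g89's `B5Eq129FreeResolventSupBoundSites` (p369124; `fs_tsite_of_tor`: an
(FS) letter with constant `C` on `Tor P` yields the same letter on `TSite d P` — `Equiv.ofBijective _ (torCast_bijective P)`, `torCast_shift`, `torCast_unshift` of
`B9Eq315FlatDictionary`).  HERE the transported letter is the WEIGHTED ∇-ROW IN SOLUTION SHAPE (storey J's (K∇′), t4-ne9-idea-1 g121 §2), its supplier on `Tor P`
being this lineage's `B5Eq129FreeResolventWeightedGradientRowOperator.norm_apply_sub_le_of_resolvent_weighted` (staged behind the build lane at the time of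
writing — hence the letter enters as the HYPOTHESIS `H`, so that this file builds on `B9Eq315FlatDictionary` + `B4TorusKernel` alone and the instance is ONE
`exact` later).  [folklore] reindexing; nothing of print is asserted.

WHY THIS FILE (cell context).  The consumers of storey J (the OWNER's `B9Eq342GreenPrimeTowerSupBoundDecay*`, plan v11 §2 (ii) «the gradient rows — THE CRUX;
idea-1 + leaf-05») live on `TSite d (towerP L m (n+1))` with `shift`∕`unshift` and the weight
`W_{x₀}(y) = Π_μ cosh(a·circAbs (P μ) ((x₀ μ − y μ : ZMod (P μ)).val))` (`B9Eq342CoshWeightSite`, written out); the (K∇) letters of this lineage live on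
`B5Prop11Plancherel.Tor P` with `± unitVec`.  This file is the socket between the two, in the solution shape that `B9Eq342GradientRowBootstrap` §4
(`norm_le_of_gradient_response_bootstrap`) consumes.

WHAT IS PROVED (sorry-free; 0 `def`; [folklore]).
* **`gradRow_tsite_of_tor`** — `H` (the `Tor P` letter for EVERY `u g c F`: equation `Σ_ν t²•((u x − u(x − e_ν)) + (u x − u(x + e_ν))) + m•u x = g x`, data
  `‖g y‖ ≤ F·W_c(y)`, output `‖u(x − e_ν) − u x‖ ≤ B·F·W_c(x)`) ⟹ on `TSite d P`: equation with `unshift`∕`shift`, data `‖g y‖ ≤ F·W_{x₀}(y)`, output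
  `‖u(unshift ν x) − u x‖ ≤ B_ν·F·W_{x₀}(x)` — same constants `B_ν` (allowed to depend on the direction, as the finite-period
  factor `1 + 2t∕(N_ν√μ)` of the supplier does).
* **`gradRow_tsite_of_tor_shift`** — the forward bond: `‖u(shift ν x) − u x‖ ≤ B_ν·F·W_{x₀}(shift ν x)` (the previous at `shift ν x`, `unshift_shift`).
HONEST SCOPE.  Plumbing only; the hypothesis `H` is NOT discharged here (its supplier is staged); no kernel, no number.  NOT summit progress (cell pub-balaban: NE9
NOT PRINTED ∕ NOT PROVED; «NE9 ⇐ the named binders»; row WALLED ON A MODEL (O-NE9-1; #5 UNRULED); spine PROVED 0∕9; rung (B)+1 finite T⁴ — NOT infinite volume, NOT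
mass gap, NOT BetaPertH, NOT Clay).  HONEST DEPENDENCY (cell line): continuum YM on T⁴ ⇐ BetaPertH ∧ nine spine estimates (0/9 proved); BetaPertH ⇐ (D1) ∧ (D4) ∧
CAP+tail; G-an2-4 gates asym, D1 and NE2/3/4.  NEW file importing `B9Eq315FlatDictionary` and `B4TorusKernel` only; nothing modified.  Net new unproved facts: 0.
-/

noncomputable section

open scoped BigOperators

namespace Literature.MathematicalPhysics.QuantumFieldTheory.Balaban1983to89.B5Eq129FreeResolventGradientRowSites

open B4Sect5Torus (TSite)
open B9SectCLatticeCarrier (shift unshift unshift_shift)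
open B5Prop11Plancherel (Tor unitVec)
open B4TorusKernel.MultiPeriod (circAbs)
open B9Eq315FlatDictionary (torCast_bijective torCast_shift torCast_unshift)

variable {d : ℕ} (P : Fin d → ℕ) [∀ i, NeZero (P i)]

/-- **TRANSPORT OF THE WEIGHTED ∇-ROW (solution shape) ALONG THE SITE DICTIONARY.**  If on b05's torus `Tor P` every solution of
`Σ_ν t²•((u x − u(x − e_ν)) + (u x − u(x + e_ν))) + m•u x = g x` with `‖g(y)‖ ≤ F·Π_μ cosh(a·d(c_μ − y_μ))` satisfies
`‖u(x − e_ν) − u(x)‖ ≤ B·F·Π_μ cosh(a·d(c_μ − x_μ))` (hypothesis `H`; `d = circAbs (P μ)` of the canonical representative), then on the chain's lattice `TSite d P`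
every solution of the same equation written with `unshift`∕`shift`, with data dominated by the weight centred at a site `x₀`, satisfies
`‖u(unshift ν x) − u(x)‖ ≤ B_ν·F·Π_μ cosh(a·d((x₀)_μ − x_μ))` — same constants `B_ν` (one per direction).  (Pattern: `B5Eq129FreeResolventSupBoundSites.fs_tsite_of_tor`.) [folklore]
[cite: Balaban1985BackgroundPropagators, (3.1) p.390, (3.3) p.391, (3.8) p.392; Balaban1984PropagatorsI, (1.29) p.23, p.36] -/
theorem gradRow_tsite_of_tor {V : Type*} [NormedAddCommGroup V] [NormedSpace ℝ V] {t m a : ℝ} {B : Fin d → ℝ}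
    (H : ∀ (u g : Tor P → V) (c : Tor P) (F : ℝ),
      (∀ x, ∑ ν, t ^ 2 • ((u x - u (x - unitVec P ν)) + (u x - u (x + unitVec P ν))) + m • u x = g x) →
      (∀ y, ‖g y‖ ≤ F * ∏ μ, Real.cosh (a * (circAbs (P μ) ((c μ - y μ : ZMod (P μ)).val) : ℝ))) →
      ∀ (ν : Fin d) (x : Tor P), ‖u (x - unitVec P ν) - u x‖ ≤ B ν * F * ∏ μ, Real.cosh (a * (circAbs (P μ) ((c μ - x μ : ZMod (P μ)).val) : ℝ)))
    {u g : TSite d P → V} (hu : ∀ x, ∑ ν, t ^ 2 • ((u x - u (unshift ν x)) + (u x - u (shift ν x))) + m • u x = g x)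
    (x₀ : TSite d P) {F : ℝ}
    (hg : ∀ y, ‖g y‖ ≤ F * ∏ μ, Real.cosh (a * (circAbs (P μ) ((((x₀ μ : ℕ) : ZMod (P μ)) - ((y μ : ℕ) : ZMod (P μ))).val) : ℝ)))
    (ν : Fin d) (x : TSite d P) :
    ‖u (unshift ν x) - u x‖ ≤ B ν * F * ∏ μ, Real.cosh (a * (circAbs (P μ) ((((x₀ μ : ℕ) : ZMod (P μ)) - ((x μ : ℕ) : ZMod (P μ))).val) : ℝ)) := by
  set e : TSite d P ≃ Tor P := Equiv.ofBijective _ (torCast_bijective P) with he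
  have hsh : ∀ κ (y : TSite d P), e (shift κ y) = e y + unitVec P κ := fun κ y => torCast_shift P κ y
  have hush : ∀ κ (y : TSite d P), e (unshift κ y) = e y - unitVec P κ := fun κ y => torCast_unshift P κ y
  have hsh' : ∀ κ (z : Tor P), e.symm (z + unitVec P κ) = shift κ (e.symm z) := fun κ z =>
    e.injective (by rw [Equiv.apply_symm_apply, hsh, Equiv.apply_symm_apply])
  have hush' : ∀ κ (z : Tor P), e.symm (z - unitVec P κ) = unshift κ (e.symm z) := fun κ z =>
    e.injective (by rw [Equiv.apply_symm_apply, hush, Equiv.apply_symm_apply])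
  have heμ : ∀ (y : TSite d P) (μ : Fin d), e y μ = ((y μ : ℕ) : ZMod (P μ)) := fun y μ => rfl
  have hsymm : ∀ (z : Tor P) (μ : Fin d), (((e.symm z) μ : ℕ) : ZMod (P μ)) = z μ := fun z μ => by
    rw [← heμ, Equiv.apply_symm_apply]
  have H' := H (fun z => u (e.symm z)) (fun z => g (e.symm z)) (e x₀) F
    (fun z => by simp only [hsh', hush']; exact hu _)
    (fun z => by
      have h := hg (e.symm z)
      simp only [hsymm] at h
      exact h)
    ν (e x)
  simp only [hush', Equiv.symm_apply_apply] at H'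
  exact H'

/-- **THE FORWARD BOND**: under the same hypothesis, `‖u(shift ν x) − u(x)‖ ≤ B_ν·F·W_{x₀}(shift ν x)` — `gradRow_tsite_of_tor` at `shift ν x` (`unshift_shift`,
`norm_sub_rev`); the weight sits at the bond's far end, as in the `Tor` letter at `x + e_ν`. [folklore] [cite: Balaban1985BackgroundPropagators, (3.3) p.391] -/
theorem gradRow_tsite_of_tor_shift {V : Type*} [NormedAddCommGroup V] [NormedSpace ℝ V] {t m a : ℝ} {B : Fin d → ℝ}
    (H : ∀ (u g : Tor P → V) (c : Tor P) (F : ℝ),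
      (∀ x, ∑ ν, t ^ 2 • ((u x - u (x - unitVec P ν)) + (u x - u (x + unitVec P ν))) + m • u x = g x) →
      (∀ y, ‖g y‖ ≤ F * ∏ μ, Real.cosh (a * (circAbs (P μ) ((c μ - y μ : ZMod (P μ)).val) : ℝ))) →
      ∀ (ν : Fin d) (x : Tor P), ‖u (x - unitVec P ν) - u x‖ ≤ B ν * F * ∏ μ, Real.cosh (a * (circAbs (P μ) ((c μ - x μ : ZMod (P μ)).val) : ℝ)))
    {u g : TSite d P → V} (hu : ∀ x, ∑ ν, t ^ 2 • ((u x - u (unshift ν x)) + (u x - u (shift ν x))) + m • u x = g x)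
    (x₀ : TSite d P) {F : ℝ}
    (hg : ∀ y, ‖g y‖ ≤ F * ∏ μ, Real.cosh (a * (circAbs (P μ) ((((x₀ μ : ℕ) : ZMod (P μ)) - ((y μ : ℕ) : ZMod (P μ))).val) : ℝ)))
    (ν : Fin d) (x : TSite d P) :
    ‖u (shift ν x) - u x‖ ≤ B ν * F * ∏ μ, Real.cosh (a * (circAbs (P μ) ((((x₀ μ : ℕ) : ZMod (P μ)) - ((shift ν x μ : ℕ) : ZMod (P μ))).val) : ℝ)) := by
  have h := gradRow_tsite_of_tor P H hu x₀ hg ν (shift ν x)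
  rwa [unshift_shift, norm_sub_rev] at h

end Literature.MathematicalPhysics.QuantumFieldTheory.Balaban1983to89.B5Eq129FreeResolventGradientRowSites

end
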